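import Mathlib
import Summits.KontsevichZagierPeriods.Zeta5Search.BrickBlockShift
import Summits.KontsevichZagierPeriods.Zeta5Search.BrickStripFactor
import Summits.KontsevichZagierPeriods.Zeta5Search.BrickStripDerivMain
import Summits.KontsevichZagierPeriods.Zeta5Search.BrickStripConstLocal

/-!
# BrickStripDerivLocal — CROSS-ROW LOCALITY of the strip derivative for EVERY ° digit,
`w₁(k₀ + Kp; n₀ + Np) ≡ p·c_{k₀,A−1}(n₀) (mod p²)`, and the two BLOCK LAWS (V), (W) of `BrickLucasAssembly`
(cell zeta5-irr)

HONEST FRAMING: systematic search; no irrationality claim unless certified. INSTRUMENT-tier arithmetic of the ζ(5)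
census cell zeta5-irr (HOME `run/shared/lean/pub/zeta5-irr/`), filed by the engine seat zi-eng (g13). WHAT THIS IS
NOT: nothing about ζ(5); no denominator saving; 0 nats/n; rung F-Z1 NOT moved. With this file both hypotheses of
`BrickLucasAssembly.lucas_of_blockLaws` are theorems (the sequel `BrickLucas` states the unconditional congruence).

## The statements (`p` odd, `A` even… not needed here: `2B ≤ A`, `1 ≤ B`; row `n = n₀ + Np` of the kernel `ε = 1`,
`n₀ < p`, ° digit `k₀ ≤ n₀`, blocks `K, K' ≤ N`; `w₁ = stripDeriv`, `V = stripSum`, `W = blockWeight … (g ≡ 1)`,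
`x = xLead = x_{A−1}`)

* `stripDeriv_zero`: the one-digit strip derivative IS `p·c_{k₀,A−1}(n₀)`: `w₁(k₀; n₀, block 0) = p·laurent A B ε n₀ k₀ 1`.
* `stripDeriv_centre_local` (centre digit `2k₀ = n₀`): `w₁ = p·λ⁽⁰⁾ + p·y·w₁⁽⁰⁾` with the `ε = 0` data, hence
  `v(w₁ − p·c_{k₀,A−1}(n₀)) ≤ exp(−2)` (`λ⁽⁰⁾ ≡ c̃_{k₀,A}(n₀)`, `BrickLambdaDigit.lambda_congr_circ`; `w₁⁽⁰⁾ ∈ pℤ_(p)`,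
  `BrickStripFactor`; `c_{k₀,A−1}(n₀) = c̃_{k₀,A}(n₀)` at the centre, `laurent_centre`).
* `stripDeriv_carry_local` (non-centre digit with a carry): `m ≥ 2` ⇒ both sides `∈ p²ℤ_(p)` (`BrickStripFactor`);
  `m = 1` ⇒ `w₁ ≡ a`, `w₁⁰ ≡ a⁰` (`BrickStripFactor.padicValuation_stripDeriv_sub_le`, `E_k` monic linear) and `a ≡ a⁰`
  (`BrickStripConstLocal.stripConst_local`), all `mod p²`.
* **`stripDeriv_local`**: for EVERY ° digit: `v(w₁(k₀ + Kp) − p·c_{k₀,A−1}(n₀)) ≤ exp(−2)` (main digits: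
  `BrickStripDerivMain`).
* **`law_V`**: `v(V(K) − p·x(n₀)) ≤ exp(−2)`. **`law_W`**: `v(W(K') − W(K) + (K'−K)·p·x(n₀)) ≤ exp(−(e+2))` for
  `p^e ∣ K − K'` (`BrickBlockShift.lambda_shift` digit by digit, expanding at whichever of the two cells is off the exact
  centre, plus `stripDeriv_local`).
-/

namespace Summit.KontsevichZagierPeriods.Zeta5Search.BrickStripDerivLocal

open Finset Nat Polynomial WithZero
open Summit.KontsevichZagierPeriods.Zeta5Search.BrickTopCoefficient (cTop)
open Summit.KontsevichZagierPeriods.Zeta5Search.BrickLaurent (laurent laurent_zero)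
open Summit.KontsevichZagierPeriods.Zeta5Search.BrickLaurentValuation (laurent_succ_succ laurent_centre)
open Summit.KontsevichZagierPeriods.Zeta5Search.BrickHarmonicBlocks (hsum)
open Summit.KontsevichZagierPeriods.Zeta5Search.BrickDigitStripCirc (carryPoly centreCarry carryPoly_eval_zero_ne_zero)
open Summit.KontsevichZagierPeriods.Zeta5Search.BrickLambda (cTop_zero_ne_zero padicValuation_two)
open Summit.KontsevichZagierPeriods.Zeta5Search.BrickLambdaDigit (lambda_congr_circ)
open Summit.KontsevichZagierPeriods.Zeta5Search.BrickResidueLawCirc (natDegree_carryPoly_le lambda_circ_le_one)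
open Summit.KontsevichZagierPeriods.Zeta5Search.BrickDigitSide (le_exp_neg_one_of_lt_one)
open Summit.KontsevichZagierPeriods.Zeta5Search.BrickLevelReduction (blockWeight cTop_one_centre)
open Summit.KontsevichZagierPeriods.Zeta5Search.BrickLucasAssembly (stripDeriv stripSum xLead xCoeff_pred_eq)
open Summit.KontsevichZagierPeriods.Zeta5Search.BrickBlockShift (lambda_shift)
open Summit.KontsevichZagierPeriods.Zeta5Search.BrickStripFactor (padicValuation_stripDeriv_le_one
  padicValuation_stripDeriv_le padicValuation_stripDeriv_sub_le)
open Summit.KontsevichZagierPeriods.Zeta5Search.BrickDepthOneCell (laurent_one_eq)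
open Summit.KontsevichZagierPeriods.Zeta5Search.BrickStripDerivMain (two_mul_ne_of_digit stripDeriv_main_local)
open Summit.KontsevichZagierPeriods.Zeta5Search.BrickStripConstLocal (centreCarry_eq_zero stripConst_local)
open Literature.NumberTheory.LFunctions (padicValuation_natCast_le_one)

noncomputable section

variable {p : ℕ} [Fact p.Prime]

/-! ## The trivial row `0` and the one-digit strip derivative -/

omit [Fact p.Prime] in
/-- `c̃_{0,A}(0) = 1`: the symmetric kernel of the empty row is `t^{−A}`. -/
theorem cTop_zero_zero (A B : ℕ) : cTop A B 0 0 0 = 1 := by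
  unfold cTop; simp

omit [Fact p.Prime] in
/-- `c̃_{0,A−1}(0) = 0`. -/
theorem laurent_zero_zero_one {A B : ℕ} (hAB : 2 * B ≤ A) : laurent A B 0 0 0 1 = 0 := by
  rw [laurent_one_eq hAB (ε := 0) (Nat.zero_le 1) le_rfl (Or.inr rfl)]
  simp

omit [Fact p.Prime] in
/-- `c_{k,A}(n) = (n/2 − k)·c̃_{k,A}(n)`: the top coefficients of the two kernels. -/
theorem cTop_one_eq (A B n k : ℕ) : cTop A B 1 n k = ((n : ℚ) / 2 - k) * cTop A B 0 n k := by
  unfold cTop; ring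

omit [Fact p.Prime] in
/-- **The one-digit strip derivative IS `p·c_{k₀,A−1}(n₀)`**: `stripDeriv A B ε p n₀ 0 k₀ 0 = p·laurent A B ε n₀ k₀ 1`. -/
theorem stripDeriv_zero {A B : ℕ} (hAB : 2 * B ≤ A) (ε n₀ k₀ : ℕ) :
    stripDeriv A B ε p n₀ 0 k₀ 0 = (p : ℚ) * laurent A B ε n₀ k₀ 1 := by
  rw [stripDeriv, cTop_zero_zero, laurent_zero_zero_one hAB]
  simp

/-! ## The centre digit -/

section centre

variable (hp2 : p ≠ 2) {A B N n₀ K k₀ : ℕ} (hAB : 2 * B ≤ A) (hB : 1 ≤ B) (hn₀ : n₀ < p) (hK : K ≤ N)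
include hp2 hAB hB hn₀ hK

/-- **THE CENTRE DIGIT**: for `2k₀ = n₀` and every block `K ≤ N`, `v(w₁(k₀ + Kp) − p·c_{k₀,A−1}(n₀)) ≤ exp(−2)`, via
`w₁ = p·λ⁽⁰⁾ + p·y·w₁⁽⁰⁾` (`y = N/2 − K`, the `ε = 0` multiplier and strip derivative of the same cell). -/
theorem stripDeriv_centre_local (hc : 2 * k₀ = n₀) :
    Rat.padicValuation p (stripDeriv A B 1 p n₀ N k₀ K - (p : ℚ) * laurent A B 1 n₀ k₀ 1) ≤ exp (-2 : ℤ) := by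
  have hp : p.Prime := Fact.out
  have hpQ : (p : ℚ) ≠ 0 := by exact_mod_cast hp.ne_zero
  have hpv : Rat.padicValuation p (p : ℚ) = exp (-1 : ℤ) := Rat.padicValuation_self p
  have hk₀ : k₀ ≤ n₀ := by omega
  have hkn : k₀ + K * p ≤ n₀ + N * p := by nlinarith
  have h0 := cTop_zero_ne_zero hK A B
  set y : ℚ := ((((N : ℤ) - 2 * K : ℤ)) : ℚ) / 2 with hy
  have hcentre : ((n₀ + N * p : ℕ) : ℚ) / 2 - ((k₀ + K * p : ℕ) : ℚ) = (p : ℚ) * y := by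
    rw [hy, ← hc]; push_cast; ring
  have hyv : Rat.padicValuation p y ≤ 1 := by
    rw [hy, map_div₀, padicValuation_two hp2, div_one, Rat.padicValuation_cast]; exact Int.padicValuation_le_one _ _
  set lam0 : ℚ := cTop A B 0 (n₀ + N * p) (k₀ + K * p) / cTop A B 0 N K with hlam0
  -- `w₁ = p·λ⁰ + p·y·w₁⁰`
  have hw : stripDeriv A B 1 p n₀ N k₀ K = (p : ℚ) * lam0 + (p : ℚ) * y * stripDeriv A B 0 p n₀ N k₀ K := by
    rw [stripDeriv, stripDeriv, show (1 : ℕ) = 0 + 1 from rfl, laurent_succ_succ A B 0 _ _ 0, laurent_zero hAB 0 hkn,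
      cTop_one_eq, hcentre, hlam0]
    field_simp
    ring
  -- the target: `c_{k₀,A−1}(n₀) = c̃_{k₀,A}(n₀)` at the centre
  have ht : laurent A B 1 n₀ k₀ 1 = cTop A B 0 n₀ k₀ := by
    rw [show (1 : ℕ) = 0 + 1 from rfl, (laurent_centre A B hc 0).1, laurent_zero hAB 0 hk₀]
  have hlam : Rat.padicValuation p (lam0 - cTop A B 0 n₀ k₀) ≤ exp (-1 : ℤ) :=
    le_exp_neg_one_of_lt_one (lambda_congr_circ hp2 (A := A) (ε := 0) hB rfl rfl hn₀ hk₀ hK)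
  have hw0 : Rat.padicValuation p (stripDeriv A B 0 p n₀ N k₀ K) ≤ exp (-1 : ℤ) :=
    padicValuation_stripDeriv_le_one hp2 hAB hn₀ hk₀ hK (Or.inr rfl)
  rw [hw, ht, show (p : ℚ) * lam0 + (p : ℚ) * y * stripDeriv A B 0 p n₀ N k₀ K - (p : ℚ) * cTop A B 0 n₀ k₀ =
    (p : ℚ) * (lam0 - cTop A B 0 n₀ k₀) + (p : ℚ) * y * stripDeriv A B 0 p n₀ N k₀ K by ring]
  refine (Valuation.map_add _ _ _).trans (max_le ?_ ?_)
  · rw [map_mul, hpv]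
    calc _ ≤ exp (-1 : ℤ) * exp (-1 : ℤ) := mul_le_mul' le_rfl hlam
      _ = _ := by rw [← exp_add]; norm_num
  · rw [map_mul, map_mul, hpv]
    calc _ ≤ exp (-1 : ℤ) * 1 * exp (-1 : ℤ) := mul_le_mul' (mul_le_mul' le_rfl hyv) hw0
      _ = _ := by rw [mul_one, ← exp_add]; norm_num

end centre

/-! ## The carry digits -/

omit [Fact p.Prime] in
/-- The boundary polynomial is monic of degree `B c_a + B c_b + ε c_c`; in particular for degree `1` its
`X¹`-coefficient is `1`. -/
theorem carryPoly_coeff_one_of_deg_one {B ε N n₀ J j₀ : ℕ}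
    (hm : B * ((n₀ + j₀) / p) + B * ((n₀ + (n₀ - j₀)) / p) + ε * centreCarry p (n₀ + N * p) (j₀ + J * p) = 1) :
    (carryPoly p B ε N n₀ J j₀).coeff 1 = 1 := by
  have hmonic : (carryPoly p B ε N n₀ J j₀).Monic := by
    unfold carryPoly
    exact ((monic_X_add_C _).pow _).mul ((monic_X_add_C _).pow _) |>.mul ((monic_X_add_C _).pow _)
  have hdeg : (carryPoly p B ε N n₀ J j₀).natDegree = 1 := by
    unfold carryPoly at hmonic ⊢
    rw [Monic.natDegree_mul (((monic_X_add_C _).pow _).mul ((monic_X_add_C _).pow _)) ((monic_X_add_C _).pow _),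
      Monic.natDegree_mul ((monic_X_add_C _).pow _) ((monic_X_add_C _).pow _),
      Monic.natDegree_pow (monic_X_add_C _), Monic.natDegree_pow (monic_X_add_C _),
      Monic.natDegree_pow (monic_X_add_C _), natDegree_X_add_C, natDegree_X_add_C, natDegree_X_add_C, mul_one,
      mul_one, mul_one]
    exact hm
  have h := hmonic.leadingCoeff
  rwa [Polynomial.leadingCoeff, hdeg] at h

section carry

variable (hp2 : p ≠ 2) {A B N n₀ K k₀ : ℕ} (hAB : 2 * B ≤ A) (hB : 1 ≤ B) (hn₀ : n₀ < p) (hk₀ : k₀ ≤ n₀) (hK : K ≤ N)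
include hp2 hAB hB hn₀ hk₀ hK

/-- **THE CARRY DIGITS**: for a non-centre digit with at least one carry and every block `K ≤ N`,
`v(w₁(k₀ + Kp) − p·c_{k₀,A−1}(n₀)) ≤ exp(−2)`. -/
theorem stripDeriv_carry_local (hc : 2 * k₀ ≠ n₀) (hcarry : p ≤ n₀ + k₀ ∨ p ≤ n₀ + (n₀ - k₀)) :
    Rat.padicValuation p (stripDeriv A B 1 p n₀ N k₀ K - (p : ℚ) * laurent A B 1 n₀ k₀ 1) ≤ exp (-2 : ℤ) := by
  have hp : p.Prime := Fact.out
  have hcen : 2 * (k₀ + K * p) ≠ n₀ + N * p ∨ (1 : ℕ) = 0 := Or.inl (two_mul_ne_of_digit hn₀ hk₀ hc N K)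
  have hcen0 : 2 * (k₀ + 0 * p) ≠ n₀ + 0 * p ∨ (1 : ℕ) = 0 := Or.inl (two_mul_ne_of_digit hn₀ hk₀ hc 0 0)
  set m : ℕ := B * ((n₀ + k₀) / p) + B * ((n₀ + (n₀ - k₀)) / p) with hm
  have hcc : ∀ N' K', centreCarry p (n₀ + N' * p) (k₀ + K' * p) = 0 := fun N' K' =>
    centreCarry_eq_zero hn₀ hk₀ hc N' K'
  have hm1 : 1 ≤ m := by
    rcases hcarry with h | h
    · have : 1 ≤ (n₀ + k₀) / p := (Nat.one_le_div_iff hp.pos).2 h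
      have := Nat.mul_le_mul hB this; omega
    · have : 1 ≤ (n₀ + (n₀ - k₀)) / p := (Nat.one_le_div_iff hp.pos).2 h
      have := Nat.mul_le_mul hB this; omega
  rw [← stripDeriv_zero hAB 1 n₀ k₀]
  -- both strip derivatives through the factorisation
  have hK0 : (0 : ℕ) ≤ 0 := le_rfl
  by_cases hm2 : 2 ≤ m
  · -- `m ≥ 2`: both sides are in `p^m ℤ_(p)`
    have h1 := padicValuation_stripDeriv_le hp2 hAB hn₀ hk₀ hK (ε := 1) hcen
    have h2 := padicValuation_stripDeriv_le hp2 hAB hn₀ hk₀ hK0 (ε := 1) hcen0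
    rw [hcc, mul_zero, add_zero] at h1 h2
    refine (Valuation.map_sub _ _ _).trans (max_le (h1.trans ?_) (h2.trans ?_)) <;>
      rw [exp_le_exp] <;> omega
  · -- `m = 1`: `w₁ ≡ a`, `w₁⁰ ≡ a⁰`, `a ≡ a⁰ (mod p²)`
    have hm_eq : m = 1 := by omega
    have h1 := padicValuation_stripDeriv_sub_le hp2 hAB hn₀ hk₀ hK (ε := 1) hcen
    have h2 := padicValuation_stripDeriv_sub_le hp2 hAB hn₀ hk₀ hK0 (ε := 1) hcen0
    have hE1 : (carryPoly p B 1 N n₀ K k₀).coeff 1 = 1 :=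
      carryPoly_coeff_one_of_deg_one (by rw [hcc, mul_zero, add_zero]; exact hm_eq)
    have hE0 : (carryPoly p B 1 0 n₀ 0 k₀).coeff 1 = 1 :=
      carryPoly_coeff_one_of_deg_one (by rw [hcc, mul_zero, add_zero]; exact hm_eq)
    rw [hcc, mul_zero, add_zero, ← hm, hm_eq, hE1, mul_one] at h1
    rw [hcc, mul_zero, add_zero, ← hm, hm_eq, hE0, mul_one] at h2
    -- the strip constants
    obtain ⟨M, rfl⟩ := Nat.exists_eq_add_of_le hK
    obtain ⟨m₀, rfl⟩ := Nat.exists_eq_add_of_le hk₀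
    have h3 := stripConst_local (A := A) (B := B) (ε := 1) hp2 le_rfl hn₀ hc K M
    simp only [zero_add] at h3
    rw [show B * ((k₀ + m₀ + k₀) / p) + B * ((k₀ + m₀ + m₀) / p) = m by rw [hm, Nat.add_sub_cancel_left], hm_eq] at h3
    have e : ∀ (w a w0 a0 : ℚ), w - w0 = (w - a) - (w0 - a0) + (a - a0) := fun _ _ _ _ => by ring
    rw [e _ (cTop A B 1 (k₀ + m₀ + (K + M) * p) (k₀ + K * p) / cTop A B 0 (K + M) K /
      (carryPoly p B 1 (K + M) (k₀ + m₀) K k₀).eval 0) _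
      (cTop A B 1 (k₀ + m₀ + 0 * p) (k₀ + 0 * p) / cTop A B 0 0 0 / (carryPoly p B 1 0 (k₀ + m₀) 0 k₀).eval 0)]
    refine (Valuation.map_add _ _ _).trans (max_le ((Valuation.map_sub _ _ _).trans (max_le (h1.trans ?_)
      (h2.trans ?_))) (h3.trans ?_)) <;> norm_num

end carry

/-! ## Every ° digit; the block laws -/

section laws

variable (hp2 : p ≠ 2) {A B N n₀ : ℕ} (hAB : 2 * B ≤ A) (hB : 1 ≤ B) (hn₀ : n₀ < p)
include hp2 hAB hB hn₀

/-- **CROSS-ROW LOCALITY OF THE STRIP DERIVATIVE, every ° digit**: for `k₀ ≤ n₀ < p` and `K ≤ N`,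
`v(w₁(k₀ + Kp; n₀ + Np) − p·c_{k₀,A−1}(n₀)) ≤ exp(−2)`. -/
theorem stripDeriv_local {K k₀ : ℕ} (hk₀ : k₀ ≤ n₀) (hK : K ≤ N) :
    Rat.padicValuation p (stripDeriv A B 1 p n₀ N k₀ K - (p : ℚ) * laurent A B 1 n₀ k₀ 1) ≤ exp (-2 : ℤ) := by
  by_cases hc : 2 * k₀ = n₀
  · exact stripDeriv_centre_local hp2 hAB hB hn₀ hK hc
  by_cases hcarry : p ≤ n₀ + k₀ ∨ p ≤ n₀ + (n₀ - k₀)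
  · exact stripDeriv_carry_local hp2 hAB hB hn₀ hk₀ hK hc hcarry
  · simp only [not_or, not_le] at hcarry
    exact stripDeriv_main_local hp2 hAB hB hn₀ hk₀ hK hcarry.1 hcarry.2 hc

/-- **LAW (V)**: `v(V(K) − p·x_{A−1}(n₀)) ≤ exp(−2)` for every block `K ≤ N`. -/
theorem law_V {K : ℕ} (hK : K ≤ N) :
    Rat.padicValuation p (stripSum A B 1 p n₀ N K - (p : ℚ) * xLead A B n₀) ≤ exp (-2 : ℤ) := by
  have hA1 : 1 ≤ A := by omega
  rw [stripSum, xLead, xCoeff_pred_eq hA1, Finset.mul_sum, ← Finset.sum_sub_distrib]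
  refine Valuation.map_sum_le _ fun k₀ hk₀ => ?_
  exact stripDeriv_local hp2 hAB hB hn₀ (by have := mem_range.1 hk₀; omega) hK

/-- **LAW (W)**: `v(W(K') − W(K) + (K' − K)·p·x_{A−1}(n₀)) ≤ exp(−(e+2))` for blocks `K, K' ≤ N` with `p^e ∣ K − K'`
(`W` = the ° block weight of the constant weight). -/
theorem law_W {K K' e : ℕ} (hK : K ≤ N) (hK' : K' ≤ N) (hdvd : (p : ℤ) ^ e ∣ (K : ℤ) - K') :
    Rat.padicValuation p (blockWeight A B 1 p n₀ N (fun _ => 1) K' - blockWeight A B 1 p n₀ N (fun _ => 1) K +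
      ((K' : ℚ) - K) * ((p : ℚ) * xLead A B n₀)) ≤ exp (-((e : ℤ) + 2)) := by
  have hp : p.Prime := Fact.out
  have hA1 : 1 ≤ A := by omega
  have hdvd' : (p : ℤ) ^ e ∣ (K' : ℤ) - K := by rw [← neg_sub]; exact (dvd_neg).2 hdvd
  have hδ : Rat.padicValuation p ((K' : ℚ) - K) ≤ exp (-(e : ℤ)) := by
    obtain ⟨c, hc⟩ := hdvd'
    rw [show (K' : ℚ) - K = (((K' : ℤ) - K : ℤ) : ℚ) by push_cast; ring, hc]
    push_cast
    rw [map_mul, map_pow, Rat.padicValuation_self, ← exp_nsmul, nsmul_eq_mul, mul_neg_one, Rat.padicValuation_cast]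
    calc _ ≤ exp (-(e : ℤ)) * 1 := mul_le_mul' le_rfl (Int.padicValuation_le_one _ _)
      _ = _ := mul_one _
  rw [blockWeight, blockWeight, xLead, xCoeff_pred_eq hA1, Finset.mul_sum, Finset.mul_sum, ← Finset.sum_sub_distrib,
    ← Finset.sum_add_distrib]
  refine Valuation.map_sum_le _ fun k₀ hk₀ => ?_
  have hk₀' : k₀ ≤ n₀ := by have := mem_range.1 hk₀; omega
  rw [one_mul, one_mul]
  -- expand at whichever of the two cells is off the exact centre
  by_cases hcen : 2 * (k₀ + K * p) ≠ n₀ + N * p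
  · have hs := lambda_shift hp2 hAB hn₀ hk₀' hK hK' (ε := 1) (Or.inl hcen) hdvd'
    have hl := stripDeriv_local hp2 hAB hB hn₀ hk₀' hK
    rw [show cTop A B 1 (n₀ + N * p) (k₀ + K' * p) / cTop A B 0 N K' - cTop A B 1 (n₀ + N * p) (k₀ + K * p) / cTop A B 0 N K +
        ((K' : ℚ) - K) * ((p : ℚ) * laurent A B 1 n₀ k₀ 1) =
      (cTop A B 1 (n₀ + N * p) (k₀ + K' * p) / cTop A B 0 N K' - cTop A B 1 (n₀ + N * p) (k₀ + K * p) / cTop A B 0 N K +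
        ((K' : ℚ) - K) * stripDeriv A B 1 p n₀ N k₀ K) -
        ((K' : ℚ) - K) * (stripDeriv A B 1 p n₀ N k₀ K - (p : ℚ) * laurent A B 1 n₀ k₀ 1) by ring]
    refine (Valuation.map_sub _ _ _).trans (max_le (hs.trans (by rw [exp_le_exp]; omega)) ?_)
    rw [map_mul]
    calc _ ≤ exp (-(e : ℤ)) * exp (-2 : ℤ) := mul_le_mul' hδ hl
      _ = _ := by rw [← exp_add]; ring_nf
  · -- the cell `(k₀, K)` is the exact centre; then `(k₀, K')` is not (unless `K = K'`)
    rw [not_ne_iff] at hcen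
    rcases eq_or_ne K' K with hKK | hKK
    · subst hKK; rw [sub_self, sub_self, zero_mul, add_zero, map_zero]; exact _root_.zero_le
    have hcen' : 2 * (k₀ + K' * p) ≠ n₀ + N * p ∨ (1 : ℕ) = 0 := by
      refine Or.inl fun h => hKK ?_
      have : K' * p = K * p := by omega
      exact Nat.eq_of_mul_eq_mul_right hp.pos this
    have hs := lambda_shift hp2 hAB hn₀ hk₀' hK' hK (ε := 1) hcen' hdvd
    have hl := stripDeriv_local hp2 hAB hB hn₀ hk₀' hK'
    rw [show cTop A B 1 (n₀ + N * p) (k₀ + K' * p) / cTop A B 0 N K' - cTop A B 1 (n₀ + N * p) (k₀ + K * p) / cTop A B 0 N K +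
        ((K' : ℚ) - K) * ((p : ℚ) * laurent A B 1 n₀ k₀ 1) =
      -(cTop A B 1 (n₀ + N * p) (k₀ + K * p) / cTop A B 0 N K - cTop A B 1 (n₀ + N * p) (k₀ + K' * p) / cTop A B 0 N K' +
        ((K : ℚ) - K') * stripDeriv A B 1 p n₀ N k₀ K') -
        ((K' : ℚ) - K) * (stripDeriv A B 1 p n₀ N k₀ K' - (p : ℚ) * laurent A B 1 n₀ k₀ 1) by ring]
    refine (Valuation.map_sub _ _ _).trans (max_le ?_ ?_)
    · rw [Valuation.map_neg]; exact hs.trans (by rw [exp_le_exp]; omega)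
    · rw [map_mul]
      calc _ ≤ exp (-(e : ℤ)) * exp (-2 : ℤ) := mul_le_mul' hδ hl
        _ = _ := by rw [← exp_add]; ring_nf

end laws

end

end Summit.KontsevichZagierPeriods.Zeta5Search.BrickStripDerivLocal
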